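import Summits.Ventures.PercRepro.S1FiveCircuitsSolidCaseOneFive

/-!
# PercRepro — THE `(13, 7)` SPREAD `s₅` CAP `150` MODULO THE TABLE AT NULLITIES `3 … 6` AND CASE 1 AT NULLITY `6` (p1, gen 33)

`proofs/P1-S2-CORANK6.md` §4l addendum 5: `qFiveSix`, `ncard_fiveCircuits_le_of_perPoint_four_five_six` (`s₅ ≤ 21 + q₄ + q₅ + q₆` at nullity `6`),
`ncard_fiveCircuits_le_thirteen_seven_of_perPoint` (`s₅ ≤ ⌊20·(21 + q₄ + q₅ + q₆)/15⌋` on the `(13, 7)` core), the nullity-`6` skeleton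
`ncard_fiveCircuitsThrough_le_max_of_planePoor_table_six` (Case 1 as the hypothesis `c₆`), the assembly
`ncard_fiveCircuits_le_thirteen_seven_of_planePoor_table`, `tPoorSix` (`t(6) = 12`), and `ncard_fiveCircuits_le_one_fifty_thirteen_seven_of_tPoorSix`
(`s₅ ≤ 150` modulo the table at `3 … 6` and Case 1 at nullity `6` with the bound `46`). The parametric Case 1 is `S1FiveCircuitsSolidSixGen`.
Axioms: standard.
-/

open scoped Matroid

namespace PercRepro

namespace S1

open Set

open FourCap

variable {α : Type}

/-- **The per-point table with three parameters**: `C(j + 3, 4)` at `j ≤ 3`, `q₄, q₅, q₆` at `4, 5, 6`, `C(j + 3, 4)` beyond. -/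
def qFiveSix (q₄ q₅ q₆ : ℕ) (j : ℕ) : ℕ :=
  if j = 4 then q₄ else if j = 5 then q₅ else if j = 6 then q₆ else (j + 3).choose 4

/-- `Σ_{j ≤ 6} qFiveSix q₄ q₅ q₆ j = 21 + q₄ + q₅ + q₆`. -/
theorem capSum_qFiveSix_six (q₄ q₅ q₆ : ℕ) : capSum (qFiveSix q₄ q₅ q₆) 6 = 21 + q₄ + q₅ + q₆ := by
  simp only [capSum, qFiveSix, Finset.sum_range_succ, Finset.sum_range_zero]
  norm_num [Nat.choose]

/-- **`s₅ ≤ 21 + q₄ + q₅ + q₆` on every spread e-free core of nullity `6`** modulo the per-point bounds at nullities `4, 5, 6`. -/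
theorem ncard_fiveCircuits_le_of_perPoint_four_five_six (M : Matroid α) [M.Finite]
    (hfree : ∀ e ∈ M.E, ∃ A ⊆ M.E \ {e}, e ∉ M.closure A ∧ e ∉ M.closure ((M.E \ {e}) \ A))
    (hns : ¬ ∃ W ⊆ M.E, W.ncard ≤ 9 ∧ W.encard = M.eRk W + 4) (hd : M.E.encard = M.eRank + 6) (q₄ q₅ q₆ : ℕ)
    (h4 : ∀ (M' : Matroid α) [M'.Finite],
      (∀ e ∈ M'.E, ∃ A ⊆ M'.E \ {e}, e ∉ M'.closure A ∧ e ∉ M'.closure ((M'.E \ {e}) \ A)) →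
      (¬ ∃ W ⊆ M'.E, W.ncard ≤ 9 ∧ W.encard = M'.eRk W + 4) → M'.E.encard = M'.eRank + 4 → ∀ e ∈ M'.E,
      {C : Set α | M'.IsCircuit C ∧ C.ncard = 5 ∧ e ∈ C}.ncard ≤ q₄)
    (h5 : ∀ (M' : Matroid α) [M'.Finite],
      (∀ e ∈ M'.E, ∃ A ⊆ M'.E \ {e}, e ∉ M'.closure A ∧ e ∉ M'.closure ((M'.E \ {e}) \ A)) →
      (¬ ∃ W ⊆ M'.E, W.ncard ≤ 9 ∧ W.encard = M'.eRk W + 4) → M'.E.encard = M'.eRank + 5 → ∀ e ∈ M'.E,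
      {C : Set α | M'.IsCircuit C ∧ C.ncard = 5 ∧ e ∈ C}.ncard ≤ q₅)
    (h6 : ∀ (M' : Matroid α) [M'.Finite],
      (∀ e ∈ M'.E, ∃ A ⊆ M'.E \ {e}, e ∉ M'.closure A ∧ e ∉ M'.closure ((M'.E \ {e}) \ A)) →
      (¬ ∃ W ⊆ M'.E, W.ncard ≤ 9 ∧ W.encard = M'.eRk W + 4) → M'.E.encard = M'.eRank + 6 → ∀ e ∈ M'.E,
      {C : Set α | M'.IsCircuit C ∧ C.ncard = 5 ∧ e ∈ C}.ncard ≤ q₆) :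
    {C : Set α | M.IsCircuit C ∧ C.ncard = 5}.ncard ≤ 21 + q₄ + q₅ + q₆ := by
  have h := ncard_fiveCircuits_le_capSum_spread_of M hfree hns (d := 6) (by exact_mod_cast hd) (qFiveSix q₄ q₅ q₆) (by
    intro M' _ hfree' hns' j hj e he
    by_cases h4' : j = 4
    · subst h4'
      simp only [qFiveSix, if_true]
      exact h4 M' hfree' hns' hj e he
    by_cases h5' : j = 5
    · subst h5'
      simp only [qFiveSix, h4', if_false, if_true]
      exact h5 M' hfree' hns' hj e he
    by_cases h6' : j = 6
    · subst h6'
      simp only [qFiveSix, h4', h5', if_false, if_true]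
      exact h6 M' hfree' hns' hj e he
    simp only [qFiveSix, h4', h5', h6', if_false]
    exact ncard_fiveCircuitsThrough_le_choose M' hj e)
  rwa [capSum_qFiveSix_six] at h

/-- **THE `(13, 7)` SPREAD `s₅` CAP MODULO THE THREE PER-POINT BOUNDS**: on the coloop-free spread e-free core of nullity `7` on `20`
points, `s₅ ≤ ⌊20·(21 + q₄ + q₅ + q₆)/15⌋`. -/
theorem ncard_fiveCircuits_le_thirteen_seven_of_perPoint (M : Matroid α) [M.Finite]
    (hfree : ∀ e ∈ M.E, ∃ A ⊆ M.E \ {e}, e ∉ M.closure A ∧ e ∉ M.closure ((M.E \ {e}) \ A))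
    (hns : ¬ ∃ W ⊆ M.E, W.ncard ≤ 9 ∧ W.encard = M.eRk W + 4) (hd : M.E.encard = M.eRank + 7)
    (hn : M.E.ncard = 20) (hK : ∀ e, ¬ M.IsColoop e) (q₄ q₅ q₆ : ℕ)
    (h4 : ∀ (M' : Matroid α) [M'.Finite],
      (∀ e ∈ M'.E, ∃ A ⊆ M'.E \ {e}, e ∉ M'.closure A ∧ e ∉ M'.closure ((M'.E \ {e}) \ A)) →
      (¬ ∃ W ⊆ M'.E, W.ncard ≤ 9 ∧ W.encard = M'.eRk W + 4) → M'.E.encard = M'.eRank + 4 → ∀ e ∈ M'.E,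
      {C : Set α | M'.IsCircuit C ∧ C.ncard = 5 ∧ e ∈ C}.ncard ≤ q₄)
    (h5 : ∀ (M' : Matroid α) [M'.Finite],
      (∀ e ∈ M'.E, ∃ A ⊆ M'.E \ {e}, e ∉ M'.closure A ∧ e ∉ M'.closure ((M'.E \ {e}) \ A)) →
      (¬ ∃ W ⊆ M'.E, W.ncard ≤ 9 ∧ W.encard = M'.eRk W + 4) → M'.E.encard = M'.eRank + 5 → ∀ e ∈ M'.E,
      {C : Set α | M'.IsCircuit C ∧ C.ncard = 5 ∧ e ∈ C}.ncard ≤ q₅)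
    (h6 : ∀ (M' : Matroid α) [M'.Finite],
      (∀ e ∈ M'.E, ∃ A ⊆ M'.E \ {e}, e ∉ M'.closure A ∧ e ∉ M'.closure ((M'.E \ {e}) \ A)) →
      (¬ ∃ W ⊆ M'.E, W.ncard ≤ 9 ∧ W.encard = M'.eRk W + 4) → M'.E.encard = M'.eRank + 6 → ∀ e ∈ M'.E,
      {C : Set α | M'.IsCircuit C ∧ C.ncard = 5 ∧ e ∈ C}.ncard ≤ q₆) :
    {C : Set α | M.IsCircuit C ∧ C.ncard = 5}.ncard ≤ 20 * (21 + q₄ + q₅ + q₆) / 15 := by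
  have h := ncard_fiveCircuits_le_mul_div_spread_of M hfree hns (d := 6) (by rw [hd]; norm_num) hn (by norm_num) hK
    (B := 21 + q₄ + q₅ + q₆)
    (fun M' _ hfree' hns' hd' => ncard_fiveCircuits_le_of_perPoint_four_five_six M' hfree' hns' hd' q₄ q₅ q₆ h4 h5 h6)
  simpa using h

/-- **THE SKELETON AT NULLITY `6`, WITH CASE 1 AS A HYPOTHESIS** (`c₆`). -/
theorem ncard_fiveCircuitsThrough_le_max_of_planePoor_table_six (M : Matroid α) [M.Finite]
    (hfree : ∀ e ∈ M.E, ∃ A ⊆ M.E \ {e}, e ∉ M.closure A ∧ e ∉ M.closure ((M.E \ {e}) \ A))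
    (hns : ¬ ∃ W ⊆ M.E, W.ncard ≤ 9 ∧ W.encard = M.eRk W + 4) (hd : M.E.encard = M.eRank + 6) (e : α)
    (t : ℕ → ℕ)
    (ht : ∀ (N' : Matroid α) [N'.Finite], PlanePoor N' → Spread8 N' → ∀ j : ℕ, N'.E.encard = N'.eRank + j → ∀ f ∈ N'.E,
      {D : Set α | N'.IsCircuit D ∧ D.ncard = 4 ∧ f ∈ D}.ncard ≤ t j)
    (c₆ : ℕ)
    (hcase1 : ∀ (M' : Matroid α) [M'.Finite],
      (∀ e ∈ M'.E, ∃ A ⊆ M'.E \ {e}, e ∉ M'.closure A ∧ e ∉ M'.closure ((M'.E \ {e}) \ A)) →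
      (¬ ∃ W ⊆ M'.E, W.ncard ≤ 9 ∧ W.encard = M'.eRk W + 4) → M'.E.encard = M'.eRank + 6 →
      ∀ (e' : α) (X : Set α), M'.eRk X = 4 → e' ∈ M'.closure X → (M'.closure X).ncard = 7 →
      {C : Set α | M'.IsCircuit C ∧ C.ncard = 5 ∧ e' ∈ C}.ncard ≤ c₆) :
    {C : Set α | M.IsCircuit C ∧ C.ncard = 5 ∧ e ∈ C}.ncard ≤ max c₆ (capSum t 6) := by
  classical
  by_cases hempty : {C : Set α | M.IsCircuit C ∧ C.ncard = 5 ∧ e ∈ C} = ∅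
  · rw [hempty, ncard_empty]; exact Nat.zero_le _
  obtain ⟨C₀, hC₀⟩ := nonempty_iff_ne_empty.2 hempty
  have heE : e ∈ M.E := hC₀.1.subset_ground hC₀.2.2
  have hel : ¬ M.IsLoop e := by
    intro hl
    have h5 := hC₀.2.1
    rw [hl.eq_of_isCircuit_mem hC₀.1 hC₀.2.2, ncard_singleton] at h5
    exact absurd h5 (by norm_num)
  have henl : M.IsNonloop e := ⟨hel, heE⟩
  have hdN := nullity_contract_singleton_of_not_isLoop M heE hel hd
  by_cases hPP : PlanePoor (M ／ {e})
  · calc {C : Set α | M.IsCircuit C ∧ C.ncard = 5 ∧ e ∈ C}.ncard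
        ≤ {D : Set α | (M ／ {e}).IsCircuit D ∧ D.ncard = 4}.ncard :=
          ncard_fiveCircuitsThrough_le_ncard_fourCircuits_contract M e
      _ ≤ capSum t 6 := ncard_fourCircuits_le_capSum_of_planePoor (M ／ {e}) hPP (spread8_contract M hns henl) hdN t ht
      _ ≤ max c₆ (capSum t 6) := le_max_right _ _
  · unfold PlanePoor at hPP
    push Not at hPP
    obtain ⟨D, hD, h4, h6⟩ := hPP
    have hDE : D ⊆ M.E := hD.subset_ground.trans (M.contract_ground_subset_ground {e})
    have heD : e ∉ D := fun h => (hD.subset_ground h).2 (mem_singleton e)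
    have hX4 : M.eRk (insert e D) = 4 := by
      rw [← eRk_contract_singleton_add_one M henl hDE heD]
      have hDf : D.Finite := M.ground_finite.subset hDE
      have h := hD.eRk_add_one_eq
      rw [← hDf.cast_ncard_eq, h4] at h
      obtain ⟨r, hr⟩ := exists_eRk_eq_coe (M ／ {e}) D
      rw [hr] at h ⊢
      have h' : r + 1 = 4 := by exact_mod_cast h
      have : r = 3 := by omega
      rw [this]
      norm_num
    have heX : e ∈ M.closure (insert e D) := M.subset_closure _ (insert_subset heE hDE) (mem_insert e D)
    have hcl : (M ／ {e}).closure D = M.closure (insert e D) \ {e} := by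
      rw [Matroid.contract_closure_eq, union_singleton]
    have h7 : (M.closure (insert e D)).ncard = 7 := by
      have hle := S2.ncard_le_of_eRk_le_of_not_nullity M 4 9 (by norm_num) hns (M.closure_subset_ground _)
        (r := 4) (by norm_num) (by rw [M.eRk_closure_eq, hX4]; norm_num)
      have hge : 6 ≤ (M.closure (insert e D)).ncard - 1 := by
        rw [← ncard_sdiff_singleton_of_mem heX, ← hcl]
        omega
      omega
    exact (hcase1 M hfree hns hd e (insert e D) hX4 heX h7).trans (le_max_left _ _)

/-- **THE `(13, 7)` SPREAD `s₅` CAP MODULO THE PLANE-POOR 8-SPREAD TABLE AND CASE 1 AT NULLITY `6`**: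
`s₅ ≤ ⌊20·(21 + max 16 (capSum t 4) + max 28 (capSum t 5) + max c₆ (capSum t 6))/15⌋`. -/
theorem ncard_fiveCircuits_le_thirteen_seven_of_planePoor_table (M : Matroid α) [M.Finite]
    (hfree : ∀ e ∈ M.E, ∃ A ⊆ M.E \ {e}, e ∉ M.closure A ∧ e ∉ M.closure ((M.E \ {e}) \ A))
    (hns : ¬ ∃ W ⊆ M.E, W.ncard ≤ 9 ∧ W.encard = M.eRk W + 4) (hd : M.E.encard = M.eRank + 7)
    (hn : M.E.ncard = 20) (hK : ∀ e, ¬ M.IsColoop e) (t : ℕ → ℕ)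
    (ht : ∀ (N' : Matroid α) [N'.Finite], PlanePoor N' → Spread8 N' → ∀ j : ℕ, N'.E.encard = N'.eRank + j → ∀ f ∈ N'.E,
      {D : Set α | N'.IsCircuit D ∧ D.ncard = 4 ∧ f ∈ D}.ncard ≤ t j)
    (c₆ : ℕ)
    (hcase1 : ∀ (M' : Matroid α) [M'.Finite],
      (∀ e ∈ M'.E, ∃ A ⊆ M'.E \ {e}, e ∉ M'.closure A ∧ e ∉ M'.closure ((M'.E \ {e}) \ A)) →
      (¬ ∃ W ⊆ M'.E, W.ncard ≤ 9 ∧ W.encard = M'.eRk W + 4) → M'.E.encard = M'.eRank + 6 →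
      ∀ (e' : α) (X : Set α), M'.eRk X = 4 → e' ∈ M'.closure X → (M'.closure X).ncard = 7 →
      {C : Set α | M'.IsCircuit C ∧ C.ncard = 5 ∧ e' ∈ C}.ncard ≤ c₆) :
    {C : Set α | M.IsCircuit C ∧ C.ncard = 5}.ncard ≤
      20 * (21 + max 16 (capSum t 4) + max 28 (capSum t 5) + max c₆ (capSum t 6)) / 15 :=
  ncard_fiveCircuits_le_thirteen_seven_of_perPoint M hfree hns hd hn hK (max 16 (capSum t 4)) (max 28 (capSum t 5))
    (max c₆ (capSum t 6))
    (fun M' _ hfree' hns' hd' e _ => ncard_fiveCircuitsThrough_le_max_of_planePoor_table M' hfree' hns' hd' e t ht)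
    (fun M' _ hfree' hns' hd' e _ =>
      ncard_fiveCircuitsThrough_le_max_of_planePoor_table_five M' hfree' hns' hd' e t ht 28
        (fun M'' _ hfree'' hns'' hd'' _ _ hX4 heX h7 =>
          ncard_fiveCircuitsThrough_le_twenty_eight_of_seven_solid_five M'' hfree'' hns'' hd'' hX4 heX h7))
    (fun M' _ hfree' hns' hd' e _ =>
      ncard_fiveCircuitsThrough_le_max_of_planePoor_table_six M' hfree' hns' hd' e t ht c₆ hcase1)

/-- **The search table up to nullity `6`**: `tPoor` with `t(6) = 12` (three disjoint 4-lines). -/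
def tPoorSix (j : ℕ) : ℕ := if j = 6 then 12 else tPoor j

/-- `Σ_{j ≤ 4} tPoorSix j = 18`. -/
theorem capSum_tPoorSix_four : capSum tPoorSix 4 = 18 := by decide

/-- `Σ_{j ≤ 5} tPoorSix j = 27`. -/
theorem capSum_tPoorSix_five : capSum tPoorSix 5 = 27 := by decide

/-- `Σ_{j ≤ 6} tPoorSix j = 39`. -/
theorem capSum_tPoorSix_six : capSum tPoorSix 6 = 39 := by decide

/-- **`s₅ ≤ 150` ON THE `(13, 7)` CORE MODULO THE TABLE AT NULLITIES `3 … 6` AND CASE 1 AT NULLITY `6` WITH THE BOUND `46`** —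
p7 g16's target for the rows `t ≥ 4` of the `(13, 7)` spread case (`20·(21 + 18 + 28 + 46)/15 = 150`). -/
theorem ncard_fiveCircuits_le_one_fifty_thirteen_seven_of_tPoorSix (M : Matroid α) [M.Finite]
    (hfree : ∀ e ∈ M.E, ∃ A ⊆ M.E \ {e}, e ∉ M.closure A ∧ e ∉ M.closure ((M.E \ {e}) \ A))
    (hns : ¬ ∃ W ⊆ M.E, W.ncard ≤ 9 ∧ W.encard = M.eRk W + 4) (hd : M.E.encard = M.eRank + 7)
    (hn : M.E.ncard = 20) (hK : ∀ e, ¬ M.IsColoop e)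
    (ht : ∀ (N' : Matroid α) [N'.Finite], PlanePoor N' → Spread8 N' → ∀ j : ℕ, 3 ≤ j → j ≤ 6 →
      N'.E.encard = N'.eRank + j → ∀ f ∈ N'.E,
      {D : Set α | N'.IsCircuit D ∧ D.ncard = 4 ∧ f ∈ D}.ncard ≤ tPoorSix j)
    (hcase1 : ∀ (M' : Matroid α) [M'.Finite],
      (∀ e ∈ M'.E, ∃ A ⊆ M'.E \ {e}, e ∉ M'.closure A ∧ e ∉ M'.closure ((M'.E \ {e}) \ A)) →
      (¬ ∃ W ⊆ M'.E, W.ncard ≤ 9 ∧ W.encard = M'.eRk W + 4) → M'.E.encard = M'.eRank + 6 →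
      ∀ (e' : α) (X : Set α), M'.eRk X = 4 → e' ∈ M'.closure X → (M'.closure X).ncard = 7 →
      {C : Set α | M'.IsCircuit C ∧ C.ncard = 5 ∧ e' ∈ C}.ncard ≤ 46) :
    {C : Set α | M.IsCircuit C ∧ C.ncard = 5}.ncard ≤ 150 := by
  have ht' : ∀ (N' : Matroid α) [N'.Finite], PlanePoor N' → Spread8 N' → ∀ j : ℕ, N'.E.encard = N'.eRank + j →
      ∀ f ∈ N'.E, {D : Set α | N'.IsCircuit D ∧ D.ncard = 4 ∧ f ∈ D}.ncard ≤ tPoorSix j := by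
    intro N' _ hN' hN8 j hj f hf
    by_cases hj2 : j ≤ 2
    · have h := tPoor_of_le_two N' hj2 hj f
      have h6 : j ≠ 6 := by omega
      simpa [tPoorSix, h6] using h
    by_cases hj6 : j ≤ 6
    · exact ht N' hN' hN8 j (by omega) hj6 hj f hf
    · refine (ncard_fourCircuitsThrough_le_choose N' hj f).trans (le_of_eq ?_)
      have h0 : j ≠ 0 := by omega
      have h1 : j ≠ 1 := by omega
      have h2 : j ≠ 2 := by omega
      have h3 : j ≠ 3 := by omega
      have h4 : j ≠ 4 := by omega
      have h5 : j ≠ 5 := by omega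
      have h6 : j ≠ 6 := by omega
      simp [tPoorSix, tPoor, h0, h1, h2, h3, h4, h5, h6]
  have h := ncard_fiveCircuits_le_thirteen_seven_of_planePoor_table M hfree hns hd hn hK tPoorSix ht' 46 hcase1
  rw [capSum_tPoorSix_four, capSum_tPoorSix_five, capSum_tPoorSix_six] at h
  exact h.trans (le_of_eq (by decide))

end S1

end PercRepro
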